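import Summits.SmoothPoincare4.SmoothPoincare4.Theses.SymplecticOrigami
import Summits.SmoothPoincare4.SmoothPoincare4.Theorems.SymplecticOrigamiNoGenusTwoDoorStubTaubesCanonicalCurveDoorLattice

/-!
# Strategist census — typed signatures (crux stmt-SmoothPoincare4-7842 `NoGenusTwoDoor`)

Companion of `STRATEGY-CENSUS.md` (crux-strategist / wall-breaker seat
`planner-cstrat-stmt-SmoothPoincare4-7842-p1-0`, 2026-08-17).  It TYPES, over existing declarations,
the objects the census discusses, so that "as a signature" is literal:

* `## Strengthen`: `PositiveDefiniteIsRationalCP2` (S⁺_PD), `PositiveDefiniteNoether` (S⁺_N),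
  `GompfBetti` (S⁺_G) — each implies the crux by the one-line arithmetic proved below
  (`noGenusTwoDoor_of_positiveDefiniteIsRationalCP2`, `…_of_positiveDefiniteNoether`,
  `…_of_gompfBetti`), none is known, and the census explains why the added generality buys no tool.
* `## Decomposition`: the best typed split found — by the ALBANESE RANK `r` of the Taubes curve —
  `TaubesCanonicalCurve` (= registered stub S1 of line canonical-cap-filling, verbatim; closed modulo
  the named fact, p87978) `→ SubAlbaneseRankLeOne → SubAlbaneseRankTwo → NoGenusTwoDoor`, glue
  `noGenusTwoDoor_of_albaneseSplit` PROVED here (pure logic).  Not filed as a route split: neither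
  piece has an input theorem (census §Decomposition); recorded so a later seat can file it verbatim.
* `## Transfer` / `## Negation` are prose (Kähler sibling; constructions) — their integer shadows are
  already theorems of `Disproof.lean` (§3 `sphereSpan_not_negDef`, §8 `pencil_a_one_dead`, §2
  `cover_tower`), not repeated.

Nothing here is a registered line; no `stub_*`.  Sorry-free.
-/

noncomputable section

set_option linter.dupNamespace false

open scoped Manifold ContDiff Topology ContinuousMap
open Set Function TopologicalSpace
open Literature.Geometry.Kaehler (MForm IsSmoothForm IsClosedForm)
open Literature.AlgebraicTopology.SingularHomology
open Literature.Topology.FourManifolds (singularHomologyZ)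
open Summit.SmoothPoincare4.SmoothPoincare4.Theses.SymplecticOrigami (NoGenusTwoDoor SymplecticChernPackage)
open Summit.SmoothPoincare4.SmoothPoincare4.Theorems.NoGenusTwoDoor.CanonicalCapFilling
  (sigPos_eq_one_and_sigNeg_eq_zero)

namespace Summit.SmoothPoincare4.SmoothPoincare4.Cruxes.NoGenusTwoDoor.StrategistCensus

/-- Model space `ℝⁿ`. -/
local notation "𝔼" n:arg => EuclideanSpace ℝ (Fin n)

/-! ## Strengthenings (census `## Strengthen`) -/

/-- **S⁺_PD — positive-definite closed symplectic 4-manifolds are rational homology `ℂP²`s.**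
For a closed connected symplectic `(N, s)` and its symplectic homological orientation `μ`
(tree: `IsSymplecticOrientationOf`), `b⁻(μ) = 0 ⇒ b₁ = 0 ∧ b₂ = 1`.  Implied by symplectic BMY
(`c₁² ≤ 3c₂` gives `b⁺ + b₁ ≤ 1`); kills the door DIRECTLY (`b⁻ = 0`, `b₁ = 2`) and every cover of an
`F₂`-like door (`b⁻ = 0`, `b₂ = d ≥ 2`).  OPEN; no tool at `c₂ ≤ 0` (Feehan–Leness Rem. 2.3).
[cite: arXiv:2410.13809, Conj. 2 and Rem. 2.3] -/
def PositiveDefiniteIsRationalCP2 : Prop :=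
  ∀ (N : Type) [TopologicalSpace N] [T2Space N] [SecondCountableTopology N] [CompactSpace N]
    [ConnectedSpace N] [ChartedSpace (𝔼 4) N] [IsManifold (𝓡 4) ∞ N] (s : MForm (𝓡 4) N ℝ 2),
    IsSmoothForm s → IsClosedForm s →
    (∀ x (v : TangentSpace (𝓡 4) x), v ≠ 0 → ∃ w, s x ![v, w] ≠ 0) →
    ∀ μ : HomologicalOrientation ℤ N 4,
      sigNeg (intersectionForm two_add_two_eq_four μ).toQuadraticMap = 0 →
      Module.finrank ℤ (singularHomologyZ N 1) = 0 ∧ Module.finrank ℤ (singularHomologyZ N 2) = 1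

/-- **S⁺_N — symplectic Noether/Castelnuovo for positive-definite manifolds:** `b⁻(μ) = 0 ⇒
b⁺(μ) ≥ b₁ + 1` (⟺ `χ_h ≥ 1`; weaker than S⁺_PD, still kills the door: `1 ≥ 3` fails, and the
`F₂`-like covers: `d ≥ d + 2` fails).  OPEN (the `b⁺ = 1` case IS the crux by Liu's table; the
`b⁺ ≥ 2` case is Gompf/Noether-type geography with Taubes' package but no `χ_h` bound in print).
[cite: arXiv:1506.08367, Question 2.11] -/
def PositiveDefiniteNoether : Prop :=
  ∀ (N : Type) [TopologicalSpace N] [T2Space N] [SecondCountableTopology N] [CompactSpace N]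
    [ConnectedSpace N] [ChartedSpace (𝔼 4) N] [IsManifold (𝓡 4) ∞ N] (s : MForm (𝓡 4) N ℝ 2),
    IsSmoothForm s → IsClosedForm s →
    (∀ x (v : TangentSpace (𝓡 4) x), v ≠ 0 → ∃ w, s x ![v, w] ≠ 0) →
    ∀ μ : HomologicalOrientation ℤ N 4,
      1 ≤ sigPos (intersectionForm two_add_two_eq_four μ).toQuadraticMap →
      sigNeg (intersectionForm two_add_two_eq_four μ).toQuadraticMap = 0 →
      Module.finrank ℤ (singularHomologyZ N 1) + 1 ≤
        sigPos (intersectionForm two_add_two_eq_four μ).toQuadraticMap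

/-- **S⁺_G — Gompf's `χ ≥ 0` question in Betti form:** a closed connected symplectic 4-manifold
with `χ = 2 − 2b₁ + b₂ < 0` has `b₁ ≥ 4` (as the `g ≥ 2` ruled surfaces do).  Strictly stronger than
the crux (it also excludes `(b₁; b⁺, b⁻) = (3; 2, 0), (3; 2, 1)`, the door's double-cover numerics);
OPEN since Gompf 1995 (Kotschick 2006). [cite: doi:10.1090/s0002-9939-06-08352-3] -/
def GompfBetti : Prop :=
  ∀ (N : Type) [TopologicalSpace N] [T2Space N] [SecondCountableTopology N] [CompactSpace N]
    [ConnectedSpace N] [ChartedSpace (𝔼 4) N] [IsManifold (𝓡 4) ∞ N] (s : MForm (𝓡 4) N ℝ 2),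
    IsSmoothForm s → IsClosedForm s →
    (∀ x (v : TangentSpace (𝓡 4) x), v ≠ 0 → ∃ w, s x ![v, w] ≠ 0) →
    2 + Module.finrank ℤ (singularHomologyZ N 2) < 2 * Module.finrank ℤ (singularHomologyZ N 1) →
    4 ≤ Module.finrank ℤ (singularHomologyZ N 1)

/-- S⁺_G ⇒ crux: the door has `χ = 2 − 4 + 1 < 0` and `b₁ = 2 < 4`. -/
theorem noGenusTwoDoor_of_gompfBetti (h : GompfBetti) : NoGenusTwoDoor := by
  intro N _ _ _ _ _ _ _ s hs hcl hnd hdoor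
  have := h N s hs hcl hnd (by omega)
  omega

/-- S⁺_N ⇒ crux.  The symplectic orientation with `b⁺ ≥ 1` is taken from the route's own support
item `SymplecticChernPackage` (McDuff–Salamon (4.1.7); named fact in the tree); the door numerics
`(b⁺, b⁻) = (1, 0)` are the LANDED lemma `sigPos_eq_one_and_sigNeg_eq_zero` (DoorLattice module,
p87978 chain). Then `b₁ + 1 ≤ b⁺` reads `3 ≤ 1`. -/
theorem noGenusTwoDoor_of_positiveDefiniteNoether (hC : SymplecticChernPackage)
    (h : PositiveDefiniteNoether) : NoGenusTwoDoor := by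
  intro N _ _ _ _ _ _ _ s hs hcl hnd hdoor
  obtain ⟨μ, K, hpos, -, -⟩ := hC N s hs hcl hnd
  have hb2 : Module.finrank ℤ (singularHomology ℤ ℤ N 2) = 1 := hdoor.2
  obtain ⟨h1, h0⟩ := sigPos_eq_one_and_sigNeg_eq_zero μ hpos hb2
  have := h N s hs hcl hnd μ hpos h0
  rw [h1] at this
  have hb1 : Module.finrank ℤ (singularHomologyZ N 1) = 2 := hdoor.1
  omega

/-- S⁺_PD ⇒ crux (same bookkeeping: the door is positive definite with `b₁ = 2 ≠ 0`). -/
theorem noGenusTwoDoor_of_positiveDefiniteIsRationalCP2 (hC : SymplecticChernPackage)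
    (h : PositiveDefiniteIsRationalCP2) : NoGenusTwoDoor := by
  intro N _ _ _ _ _ _ _ s hs hcl hnd hdoor
  obtain ⟨μ, K, hpos, -, -⟩ := hC N s hs hcl hnd
  have hb2 : Module.finrank ℤ (singularHomology ℤ ℤ N 2) = 1 := hdoor.2
  obtain ⟨-, h0⟩ := sigPos_eq_one_and_sigNeg_eq_zero μ hpos hb2
  have := (h N s hs hcl hnd μ h0).1
  have hb1 : Module.finrank ℤ (singularHomologyZ N 1) = 2 := hdoor.1
  omega

/-! ## Decomposition by the Albanese rank of the Taubes curve (census `## Decomposition`) -/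

/-- Registered stub S1 of line canonical-cap-filling, VERBATIM (closed modulo the named fact
`taubes_canonicalClass_symplecticCurve_four`, tree theorem
`CanonicalCapFilling.stub_taubesCanonicalCurve_of_taubes`, p87978): a door contains an embedded
symplectic genus-2 surface `B = b(S)` with meridian-injective complement. [cite: Taubes1995, Thm. A] -/
def TaubesCanonicalCurve : Prop :=
  ∀ (N : Type) [TopologicalSpace N] [T2Space N] [SecondCountableTopology N] [CompactSpace N]
    [ConnectedSpace N] [ChartedSpace (𝔼 4) N] [IsManifold (𝓡 4) ∞ N] (s : MForm (𝓡 4) N ℝ 2),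
    IsSmoothForm s → IsClosedForm s →
    (∀ x (v : TangentSpace (𝓡 4) x), v ≠ 0 → ∃ w, s x ![v, w] ≠ 0) →
    Module.finrank ℤ (singularHomologyZ N 1) = 2 → Module.finrank ℤ (singularHomologyZ N 2) = 1 →
    ∃ (S : Type) (_ : TopologicalSpace S) (_ : T2Space S) (_ : CompactSpace S) (_ : ConnectedSpace S)
      (_ : ChartedSpace (𝔼 2) S) (_ : IsManifold (𝓡 2) ∞ S) (b : S → N),
      Module.finrank ℤ (singularHomologyZ S 1) = 4 ∧
      Manifold.IsSmoothEmbedding (𝓡 2) (𝓡 4) ∞ b ∧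
      (∀ y (v : TangentSpace (𝓡 2) y), v ≠ 0 → ∃ w : TangentSpace (𝓡 2) y,
        s (b y) ![mfderiv (𝓡 2) (𝓡 4) b y v, mfderiv (𝓡 2) (𝓡 4) b y w] ≠ 0) ∧
      Function.Injective (singularHomology.map ℤ ℤ
        (⟨Subtype.val, continuous_subtype_val⟩ : C(↥(Set.range b)ᶜ, N)) 1)

/-- The ALBANESE RANK of an embedded surface `b : S → N`: the rank of
`b_* : H₁(S; ℤ) → H₁(N; ℤ)` (= rank of `H¹(N; ℚ) → H¹(S; ℚ)`), `r ∈ {0, 1, 2}` for a door. -/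
def albaneseRank {S N : Type} [TopologicalSpace S] [TopologicalSpace N] (b : C(S, N)) : ℕ :=
  Module.finrank ℤ (LinearMap.range (singularHomology.map ℤ ℤ b 1).hom)

/-- **Sub-crux `r ≤ 1`** (the Taubes curve is Albanese-inessential in at least one direction:
`B` lifts to an infinite cyclic cover; complement `W` has `b₃ ≥ 1`, not Weinstein). -/
def SubAlbaneseRankLeOne : Prop :=
  ∀ (N : Type) [TopologicalSpace N] [T2Space N] [SecondCountableTopology N] [CompactSpace N]
    [ConnectedSpace N] [ChartedSpace (𝔼 4) N] [IsManifold (𝓡 4) ∞ N] (s : MForm (𝓡 4) N ℝ 2)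
    (S : Type) [TopologicalSpace S] [T2Space S] [CompactSpace S] [ConnectedSpace S]
    [ChartedSpace (𝔼 2) S] [IsManifold (𝓡 2) ∞ S] (b : S → N)
    (hb : Manifold.IsSmoothEmbedding (𝓡 2) (𝓡 4) ∞ b),
    IsSmoothForm s → IsClosedForm s →
    (∀ x (v : TangentSpace (𝓡 4) x), v ≠ 0 → ∃ w, s x ![v, w] ≠ 0) →
    Module.finrank ℤ (singularHomologyZ N 1) = 2 → Module.finrank ℤ (singularHomologyZ N 2) = 1 →
    Module.finrank ℤ (singularHomologyZ S 1) = 4 →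
    (∀ y (v : TangentSpace (𝓡 2) y), v ≠ 0 → ∃ w : TangentSpace (𝓡 2) y,
      s (b y) ![mfderiv (𝓡 2) (𝓡 4) b y v, mfderiv (𝓡 2) (𝓡 4) b y w] ≠ 0) →
    Function.Injective (singularHomology.map ℤ ℤ
      (⟨Subtype.val, continuous_subtype_val⟩ : C(↥(Set.range b)ᶜ, N)) 1) →
    albaneseRank (⟨b, hb.isEmbedding.continuous⟩ : C(S, N)) ≤ 1 → False

/-- **Sub-crux `r = 2`** (Albanese-essential Taubes curve: `H₁(∂W) ↠ H₁(W)`, `(b₁,b₂,b₃)(W) =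
(2,2,0)`, the Weinstein-shaped case; the ONLY case a fold of a homotopy 4-sphere can use). -/
def SubAlbaneseRankTwo : Prop :=
  ∀ (N : Type) [TopologicalSpace N] [T2Space N] [SecondCountableTopology N] [CompactSpace N]
    [ConnectedSpace N] [ChartedSpace (𝔼 4) N] [IsManifold (𝓡 4) ∞ N] (s : MForm (𝓡 4) N ℝ 2)
    (S : Type) [TopologicalSpace S] [T2Space S] [CompactSpace S] [ConnectedSpace S]
    [ChartedSpace (𝔼 2) S] [IsManifold (𝓡 2) ∞ S] (b : S → N)
    (hb : Manifold.IsSmoothEmbedding (𝓡 2) (𝓡 4) ∞ b),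
    IsSmoothForm s → IsClosedForm s →
    (∀ x (v : TangentSpace (𝓡 4) x), v ≠ 0 → ∃ w, s x ![v, w] ≠ 0) →
    Module.finrank ℤ (singularHomologyZ N 1) = 2 → Module.finrank ℤ (singularHomologyZ N 2) = 1 →
    Module.finrank ℤ (singularHomologyZ S 1) = 4 →
    (∀ y (v : TangentSpace (𝓡 2) y), v ≠ 0 → ∃ w : TangentSpace (𝓡 2) y,
      s (b y) ![mfderiv (𝓡 2) (𝓡 4) b y v, mfderiv (𝓡 2) (𝓡 4) b y w] ≠ 0) →
    Function.Injective (singularHomology.map ℤ ℤ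
      (⟨Subtype.val, continuous_subtype_val⟩ : C(↥(Set.range b)ᶜ, N)) 1) →
    2 ≤ albaneseRank (⟨b, hb.isEmbedding.continuous⟩ : C(S, N)) → False

/-- **Glue of the typed split (PROVED, pure logic):**
`TaubesCanonicalCurve → SubAlbaneseRankLeOne → SubAlbaneseRankTwo → NoGenusTwoDoor`. -/
theorem noGenusTwoDoor_of_albaneseSplit (hT : TaubesCanonicalCurve) (h₁ : SubAlbaneseRankLeOne)
    (h₂ : SubAlbaneseRankTwo) : NoGenusTwoDoor := by
  intro N _ _ _ _ _ _ _ s hs hcl hnd hdoor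
  obtain ⟨S, _, _, _, _, _, _, b, hS4, hb, hsymp, hinj⟩ := hT N s hs hcl hnd hdoor.1 hdoor.2
  rcases le_or_gt (albaneseRank (⟨b, hb.isEmbedding.continuous⟩ : C(S, N))) 1 with hr | hr
  · exact h₁ N s S b hb hs hcl hnd hdoor.1 hdoor.2 hS4 hsymp hinj hr
  · exact h₂ N s S b hb hs hcl hnd hdoor.1 hdoor.2 hS4 hsymp hinj (by omega)

/-! ## An equivalent form recorded for provers (census remark) -/

/-- **Equivalent form Ω:** "every closed connected symplectic 4-manifold with `b₂ = 1` has
`b₁ = 0`" (a rational homology `ℂP²`: `ℂP²` or a symplectic fake plane).  By parity and Liu's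
table (`Disproof.liu_table`) `b₂ = 1` forces `b₁ ∈ {0, 2}`, so this is the crux restated; it is
the form in which the literature would recognise it. -/
def SymplecticBTwoOneIsRationalCP2 : Prop :=
  ∀ (N : Type) [TopologicalSpace N] [T2Space N] [SecondCountableTopology N] [CompactSpace N]
    [ConnectedSpace N] [ChartedSpace (𝔼 4) N] [IsManifold (𝓡 4) ∞ N] (s : MForm (𝓡 4) N ℝ 2),
    IsSmoothForm s → IsClosedForm s →
    (∀ x (v : TangentSpace (𝓡 4) x), v ≠ 0 → ∃ w, s x ![v, w] ≠ 0) →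
    Module.finrank ℤ (singularHomologyZ N 2) = 1 → Module.finrank ℤ (singularHomologyZ N 1) = 0

theorem noGenusTwoDoor_of_bTwoOne (h : SymplecticBTwoOneIsRationalCP2) : NoGenusTwoDoor := by
  intro N _ _ _ _ _ _ _ s hs hcl hnd hdoor
  have := h N s hs hcl hnd hdoor.2
  omega

end Summit.SmoothPoincare4.SmoothPoincare4.Cruxes.NoGenusTwoDoor.StrategistCensus
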